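/-
Copyright (c) 2026 the pub-hodgecm-mathlib formalisation cell (harness21).  Prover seat hodgecm-mathlib-LH4-p08 (g2), req620 Track A «(D-RAM) FOUR-FRAME» squad, unit U3_Laws (iii),
MS ROAD STAGE B (dealer LH4-plan (g10) WORD #55 ∕ (g11) WORD #1; Stage B lead LH4-p10 (g2), MS ledger LH4-p11 (g0)): brick B2 «AXIS EXPONENTS» of `SPEC-StageB.v1.LH4p10g2.md` §B.  2026-09-03.
-/
import Summits.HodgeConjecture.HodgeConjecture.Theorems.F0P3cDyRamDiagonalStableLatticeHNF   -- ★ p855280 (LH4-p08 (g0)): `mem_latt_hnf_iff` (membership in the HNF lattice `latt [[1,0,0],[x,p,0],[y,z,r]]`)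
import HarnessLib

/-!
# Crux `H413`, line LH4 «(D-RAM) FOUR-FRAME» road — unit U3_Laws (iii), MS ROAD STAGE B, brick B2 «AXIS EXPONENTS»: when does a coordinate-axis vector `t·e_i` lie in the HNF
# lattice `latt V`, `V = [[1,0,0],[x,p,0],[y,z,r]]`?  (`e₂`: `|t| ≤ |r|`; `e₁`: `|t| ≤ |p| ∧ |t z| ≤ |p r|`; `e₀`: `|t| ≤ 1 ∧ |t x| ≤ |p| ∧ |t (y p − x z)| ≤ |p r|`)

Cell `hodgecm-mathlib` (D-0151), FLOOR 0, crux item H413 = `stmt-HodgeConjecture-24833`, route of record `HCCMUnconditional`; squad F0∕P3c∕LH4 (req620).  THEOREMS ONLY (no `def`,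
no instance, no notation, no `sorry`, default heartbeats); lane `--supports stmt-HodgeConjecture-24833 --as helper` (count-neutral).  Brick B2 of the Stage B signature sheet
`F0/P3c/LH4/LH4-p10/g2/SPEC-StageB.v1.LH4p10g2.md` §B (LH4-p10 (g2)); consumer = B3 «DUALISABLE STRATA» (the three AXIS EXPONENTS `a_i = max {v t : t·e_i ∈ latt V}` of MEMO v2 §1
are read off these criteria: `a₂ = c`, `a₁ = min(b, b + c − v z)`, `a₀ = min(0, b − v x, b + c − v(y ϖ^b − x z))` in additive notation).

WHAT IS PROVED (generic valued field `K`, `Valued K ℤᵐ⁰`; `x y z p r t : K`, `p r ≠ 0` — at the HNF point `p = ϖ^b`, `r = ϖ^c`; all three are one-line instances of ★ p855280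
`mem_latt_hnf_iff` at `w = Pi.single i t`):
* `single_two_mem_latt_hnf_iff`  — `t·e₂ ∈ latt V ↔ |t| ≤ |r|`;
* `single_one_mem_latt_hnf_iff`  — `t·e₁ ∈ latt V ↔ |t| ≤ |p| ∧ |t·z| ≤ |p·r|`;
* `single_zero_mem_latt_hnf_iff` — `t·e₀ ∈ latt V ↔ |t| ≤ 1 ∧ |t·x| ≤ |p| ∧ |t·(y·p − x·z)| ≤ |p·r|` (the sheet's §B line omits the first conjunct `|t| ≤ 1`; it is NOT implied by
  the other two — e.g. `x = y = 0` — and it is what `latt V ≤ 𝒪³` says on the first coordinate, so it is stated);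
* the `ϖ`-power forms `single_two_mem_latt_hnf_pow_iff`, `single_one_mem_latt_hnf_pow_iff`, `single_zero_mem_latt_hnf_pow_iff` at `p = ϖ^b`, `r = ϖ^c` (`ϖ ≠ 0`), right-hand sides
  in `|ϖ|^b`, `|ϖ|^(b+c)`.
HONEST LABEL.  Count-neutral; nothing printed is asserted; the census laws stay PROVER TARGETS; `HC_CM` is proved only modulo the 7 printed citations (2 remaining named inputs: hLiu418 =
`stmt-HodgeConjecture-24832`, h413 = `stmt-HodgeConjecture-24833`) until rung 0 closes.

## References
* [Serre1980Trees] J.-P. Serre, *Trees*, Springer (1980), Ch. II §1.1 (lattices `g·𝒪^N`; Hermite normal form representatives).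
* [BruhatTits1972] F. Bruhat, J. Tits, *Groupes réductifs sur un corps local I*, Publ. Math. IHÉS 41 (1972), §10 (the apartment of the diagonal torus: axis exponents of a lattice).
-/

set_option autoImplicit false

noncomputable section

namespace Summit.HodgeConjecture.HodgeConjecture.Cruxes.H413.F0P3cDyRamDiagonalHNFAxisExponents

open Matrix
open Literature.NumberTheory.Automorphic Literature.NumberTheory.Automorphic.HermitianLattice
open Literature.NumberTheory.Automorphic.UnitaryLatticeTree
open Summit.HodgeConjecture.HodgeConjecture.Cruxes.H413.F0P3cDyRamDiagonalStableLatticeHNF (mem_latt_hnf_iff)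
open scoped Valued WithZero Matrix MatrixGroups

variable {K : Type*} [Field K] [Valued K ℤᵐ⁰]

/-! ## §1 The three axis criteria at a general HNF point `V = [[1,0,0],[x,p,0],[y,z,r]]`, `p r ≠ 0` -/

/-- **`t·e₂ ∈ latt V ↔ |t| ≤ |r|`** (the last column of `V` is `r·e₂`). [cite: Serre1980Trees, II §1.1] [cite: BruhatTits1972, §10] -/
theorem single_two_mem_latt_hnf_iff (x y z : K) {p r : K} (hp : p ≠ 0) (hr : r ≠ 0) (t : K) :
    (Pi.single (2 : Fin 3) t : Fin 3 → K) ∈ latt (Matrix.of ![![1, 0, 0], ![x, p, 0], ![y, z, r]]) ↔ Valued.v t ≤ Valued.v r := by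
  have hvp : 0 < Valued.v p := (Valuation.pos_iff _).2 hp
  rw [mem_latt_hnf_iff x y z hp hr]
  simp only [Pi.single_apply, Fin.reduceEq, if_false, if_true, mul_zero, sub_zero, map_zero, zero_le, true_and]
  rw [map_mul, map_mul Valued.v p r, mul_comm (Valued.v p) (Valued.v r)]
  exact mul_le_mul_iff_left₀ hvp

/-- **`t·e₁ ∈ latt V ↔ |t| ≤ |p| ∧ |t·z| ≤ |p·r|`** (solve `V u = t·e₁`: `u₀ = 0`, `u₁ = t∕p`, `u₂ = −z t∕(p r)`). [cite: Serre1980Trees, II §1.1] [cite: BruhatTits1972, §10] -/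
theorem single_one_mem_latt_hnf_iff (x y z : K) {p r : K} (hp : p ≠ 0) (hr : r ≠ 0) (t : K) :
    (Pi.single (1 : Fin 3) t : Fin 3 → K) ∈ latt (Matrix.of ![![1, 0, 0], ![x, p, 0], ![y, z, r]]) ↔
      Valued.v t ≤ Valued.v p ∧ Valued.v (t * z) ≤ Valued.v (p * r) := by
  rw [mem_latt_hnf_iff x y z hp hr]
  simp only [Pi.single_apply, Fin.reduceEq, if_false, if_true, mul_zero, sub_zero, map_zero, zero_le_one, true_and, zero_mul, zero_sub,
    Valuation.map_neg, mul_comm z t]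

/-- **`t·e₀ ∈ latt V ↔ |t| ≤ 1 ∧ |t·x| ≤ |p| ∧ |t·(y·p − x·z)| ≤ |p·r|`** (solve `V u = t·e₀`: `u₀ = t`, `u₁ = −x t∕p`, `u₂ = t(x z − y p)∕(p r)`).  The first conjunct is NOT redundant.
[cite: Serre1980Trees, II §1.1] [cite: BruhatTits1972, §10] -/
theorem single_zero_mem_latt_hnf_iff (x y z : K) {p r : K} (hp : p ≠ 0) (hr : r ≠ 0) (t : K) :
    (Pi.single (0 : Fin 3) t : Fin 3 → K) ∈ latt (Matrix.of ![![1, 0, 0], ![x, p, 0], ![y, z, r]]) ↔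
      Valued.v t ≤ 1 ∧ Valued.v (t * x) ≤ Valued.v p ∧ Valued.v (t * (y * p - x * z)) ≤ Valued.v (p * r) := by
  rw [mem_latt_hnf_iff x y z hp hr]
  simp only [Pi.single_apply, Fin.reduceEq, if_false, if_true, zero_sub]
  have h1 : Valued.v (-(x * t)) = Valued.v (t * x) := by rw [Valuation.map_neg, mul_comm]
  have h2 : Valued.v (-(y * t) * p - z * -(x * t)) = Valued.v (t * (y * p - x * z)) := by
    rw [← Valuation.map_neg]; congr 1; ring
  rw [h1, h2]

/-! ## §2 The `ϖ`-power forms at `p = ϖ^b`, `r = ϖ^c` -/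

/-- `t·e₂ ∈ latt V(b,c) ↔ |t| ≤ |ϖ|^c`. [cite: Serre1980Trees, II §1.1] -/
theorem single_two_mem_latt_hnf_pow_iff {ϖ : K} (hϖ : ϖ ≠ 0) (b c : ℕ) (x y z t : K) :
    (Pi.single (2 : Fin 3) t : Fin 3 → K) ∈ latt (Matrix.of ![![1, 0, 0], ![x, ϖ ^ b, 0], ![y, z, ϖ ^ c]]) ↔ Valued.v t ≤ Valued.v ϖ ^ c := by
  rw [single_two_mem_latt_hnf_iff x y z (pow_ne_zero b hϖ) (pow_ne_zero c hϖ), map_pow]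

/-- `t·e₁ ∈ latt V(b,c) ↔ |t| ≤ |ϖ|^b ∧ |t·z| ≤ |ϖ|^(b+c)`. [cite: Serre1980Trees, II §1.1] -/
theorem single_one_mem_latt_hnf_pow_iff {ϖ : K} (hϖ : ϖ ≠ 0) (b c : ℕ) (x y z t : K) :
    (Pi.single (1 : Fin 3) t : Fin 3 → K) ∈ latt (Matrix.of ![![1, 0, 0], ![x, ϖ ^ b, 0], ![y, z, ϖ ^ c]]) ↔
      Valued.v t ≤ Valued.v ϖ ^ b ∧ Valued.v (t * z) ≤ Valued.v ϖ ^ (b + c) := by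
  rw [single_one_mem_latt_hnf_iff x y z (pow_ne_zero b hϖ) (pow_ne_zero c hϖ), ← pow_add, map_pow, map_pow]

/-- `t·e₀ ∈ latt V(b,c) ↔ |t| ≤ 1 ∧ |t·x| ≤ |ϖ|^b ∧ |t·(y·ϖ^b − x·z)| ≤ |ϖ|^(b+c)`. [cite: Serre1980Trees, II §1.1] -/
theorem single_zero_mem_latt_hnf_pow_iff {ϖ : K} (hϖ : ϖ ≠ 0) (b c : ℕ) (x y z t : K) :
    (Pi.single (0 : Fin 3) t : Fin 3 → K) ∈ latt (Matrix.of ![![1, 0, 0], ![x, ϖ ^ b, 0], ![y, z, ϖ ^ c]]) ↔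
      Valued.v t ≤ 1 ∧ Valued.v (t * x) ≤ Valued.v ϖ ^ b ∧ Valued.v (t * (y * ϖ ^ b - x * z)) ≤ Valued.v ϖ ^ (b + c) := by
  rw [single_zero_mem_latt_hnf_iff x y z (pow_ne_zero b hϖ) (pow_ne_zero c hϖ), ← pow_add, map_pow, map_pow]

end Summit.HodgeConjecture.HodgeConjecture.Cruxes.H413.F0P3cDyRamDiagonalHNFAxisExponents

end
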